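import Summits.MatrixMultiplication.OmegaCensus.BoxKeyLiftModel

/-!
# ω-census, family (b3): conjecture C9 (b) — the `S₃ × S₃` CONFIGURATION is box-useless (ratio `≥ 2`), uniformly

HONEST FRAMING (pub-omega census; verbatim): lottery ticket; floor = certified bounds/negative ranges.
Census BOOKKEEPING (conjecture C9 of the cell, STRUCTURE.md §2, prereg P-032.1 'S₃ × S₃: α ≥ 68 by certificate'; pub-omega
kernel-l4 gen 16, task K-5): the first client of the model-coordinates key lift `BoxKeyLiftModel`.

**Theorem (`S3S3Config.not_boxUseful`).** Let `z, u, x, y ∈ G` with `z³ = u³ = 1`, `z, u ≠ 1`, `zu = uz`, `x z x⁻¹ = z⁻¹`,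
`x u x⁻¹ = u`, `y z y⁻¹ = z`, `y u y⁻¹ = u⁻¹`, `xy = yx` — two commuting '`S₃`-pairs' (NOTHING assumed on the orders of `x, y`:
`x², y²` are merely central in `⟨z,u,x,y⟩`).  Then `G` is NOT box-useful: the box `G × {1, z, x} × {1, u, zy}` carries `2|G|`
independent cells — key lift over `N = ⟨z, u⟩ ≅ C₃²` with an `18`-element pattern (`18/9 = 2`), found by the seat's key-graph
search and checked here by `decide` in the model `Multiplicative (ZMod 3)²` (81 gauge words by one simp normal form).
**Corollaries.** `S₃ × S₃`, `S₃ × S₃ × A`, `Dic₃ × S₃`, `Dih(C₃²)` extended by a second independent inverting element, … ;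
in particular **`α(S₃ × S₃) ≥ 72 = 2·36`** (the census certificate had `68`) — P-032.1 is now KERNEL and uniform.  This is an
endpoint configuration of the centreless branch of the non-nilpotent analysis.  Nothing here is progress on `ω`.
-/

namespace Summit.MatrixMultiplication.OmegaCensus

open Finset ProductBoxBound KeyLift KleinRot

namespace S3S3Config

/-- The coordinate model `M = C₃ × C₃` (multiplicative). [folklore] -/
abbrev M := Multiplicative (ZMod 3) × Multiplicative (ZMod 3)

/-- Coordinates `v p q = (z^p, u^q)` in the model. [folklore] -/
def v (p q : ZMod 3) : M := (Multiplicative.ofAdd p, Multiplicative.ofAdd q)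

/-- Conjugation by `x` in coordinates: `(p, q) ↦ (-p, q)`. [folklore] -/
def σx : M →* M where
  toFun m := (m.1⁻¹, m.2)
  map_one' := by decide
  map_mul' := by decide

/-- Conjugation by `y` in coordinates: `(p, q) ↦ (p, -q)`. [folklore] -/
def σy : M →* M where
  toFun m := (m.1, m.2⁻¹)
  map_one' := by decide
  map_mul' := by decide

/-- `σx` is an involution. [folklore] -/
theorem σx_σx : ∀ m, σx (σx m) = m := by decide
/-- `σy` is an involution. [folklore] -/
theorem σy_σy : ∀ m, σy (σy m) = m := by decide

/-- The gauge table of the box `{1, z, x} × {1, u, zy}` in coordinates (machine-generated from the model). [folklore] -/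
def γ : Three → Three → Three → Three → M
  | .i0, .i0, .i0, .i0 => v 0 0
  | .i0, .i0, .i0, .i1 => v 0 0
  | .i0, .i0, .i0, .i2 => v 0 0
  | .i0, .i0, .i1, .i0 => v 0 0
  | .i0, .i0, .i1, .i1 => v 0 0
  | .i0, .i0, .i1, .i2 => v 0 0
  | .i0, .i0, .i2, .i0 => v 0 0
  | .i0, .i0, .i2, .i1 => v 0 0
  | .i0, .i0, .i2, .i2 => v 2 0
  | .i0, .i1, .i0, .i0 => v 0 0
  | .i0, .i1, .i0, .i1 => v 0 0
  | .i0, .i1, .i0, .i2 => v 0 2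
  | .i0, .i1, .i1, .i0 => v 0 0
  | .i0, .i1, .i1, .i1 => v 0 0
  | .i0, .i1, .i1, .i2 => v 0 2
  | .i0, .i1, .i2, .i0 => v 0 0
  | .i0, .i1, .i2, .i1 => v 0 0
  | .i0, .i1, .i2, .i2 => v 2 2
  | .i0, .i2, .i0, .i0 => v 0 0
  | .i0, .i2, .i0, .i1 => v 0 1
  | .i0, .i2, .i0, .i2 => v 0 0
  | .i0, .i2, .i1, .i0 => v 0 0
  | .i0, .i2, .i1, .i1 => v 0 1
  | .i0, .i2, .i1, .i2 => v 0 0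
  | .i0, .i2, .i2, .i0 => v 0 0
  | .i0, .i2, .i2, .i1 => v 0 1
  | .i0, .i2, .i2, .i2 => v 2 0
  | .i1, .i0, .i0, .i0 => v 0 0
  | .i1, .i0, .i0, .i1 => v 0 0
  | .i1, .i0, .i0, .i2 => v 0 0
  | .i1, .i0, .i1, .i0 => v 0 0
  | .i1, .i0, .i1, .i1 => v 0 0
  | .i1, .i0, .i1, .i2 => v 0 0
  | .i1, .i0, .i2, .i0 => v 2 0
  | .i1, .i0, .i2, .i1 => v 2 0
  | .i1, .i0, .i2, .i2 => v 1 0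
  | .i1, .i1, .i0, .i0 => v 0 0
  | .i1, .i1, .i0, .i1 => v 0 0
  | .i1, .i1, .i0, .i2 => v 0 2
  | .i1, .i1, .i1, .i0 => v 0 0
  | .i1, .i1, .i1, .i1 => v 0 0
  | .i1, .i1, .i1, .i2 => v 0 2
  | .i1, .i1, .i2, .i0 => v 2 0
  | .i1, .i1, .i2, .i1 => v 2 0
  | .i1, .i1, .i2, .i2 => v 1 2
  | .i1, .i2, .i0, .i0 => v 0 0
  | .i1, .i2, .i0, .i1 => v 0 1
  | .i1, .i2, .i0, .i2 => v 0 0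
  | .i1, .i2, .i1, .i0 => v 0 0
  | .i1, .i2, .i1, .i1 => v 0 1
  | .i1, .i2, .i1, .i2 => v 0 0
  | .i1, .i2, .i2, .i0 => v 2 0
  | .i1, .i2, .i2, .i1 => v 2 1
  | .i1, .i2, .i2, .i2 => v 1 0
  | .i2, .i0, .i0, .i0 => v 0 0
  | .i2, .i0, .i0, .i1 => v 0 0
  | .i2, .i0, .i0, .i2 => v 1 0
  | .i2, .i0, .i1, .i0 => v 1 0
  | .i2, .i0, .i1, .i1 => v 1 0
  | .i2, .i0, .i1, .i2 => v 2 0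
  | .i2, .i0, .i2, .i0 => v 0 0
  | .i2, .i0, .i2, .i1 => v 0 0
  | .i2, .i0, .i2, .i2 => v 0 0
  | .i2, .i1, .i0, .i0 => v 0 0
  | .i2, .i1, .i0, .i1 => v 0 0
  | .i2, .i1, .i0, .i2 => v 1 2
  | .i2, .i1, .i1, .i0 => v 1 0
  | .i2, .i1, .i1, .i1 => v 1 0
  | .i2, .i1, .i1, .i2 => v 2 2
  | .i2, .i1, .i2, .i0 => v 0 0
  | .i2, .i1, .i2, .i1 => v 0 0
  | .i2, .i1, .i2, .i2 => v 0 2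
  | .i2, .i2, .i0, .i0 => v 0 0
  | .i2, .i2, .i0, .i1 => v 0 1
  | .i2, .i2, .i0, .i2 => v 1 0
  | .i2, .i2, .i1, .i0 => v 1 0
  | .i2, .i2, .i1, .i1 => v 1 1
  | .i2, .i2, .i1, .i2 => v 2 0
  | .i2, .i2, .i2, .i0 => v 0 0
  | .i2, .i2, .i2, .i1 => v 0 1
  | .i2, .i2, .i2, .i2 => v 0 0

/-- The `18`-element key pattern (machine-found; `18 = 2·|C₃²|`). [folklore] -/
def T₀ : Finset (M × Three × Three) :=
  {(v 1 0, .i0, .i0), (v 2 2, .i0, .i0), (v 2 1, .i0, .i1), (v 1 1, .i0, .i2), (v 0 0, .i1, .i0), (v 1 2, .i1, .i0), (v 0 2, .i1, .i1), (v 1 1, .i1, .i1), (v 0 1, .i1, .i2), (v 0 2, .i1, .i2), (v 2 0, .i1, .i2), (v 0 2, .i2, .i0), (v 2 0, .i2, .i0), (v 0 1, .i2, .i1), (v 0 0, .i2, .i2), (v 0 1, .i2, .i2), (v 1 1, .i2, .i2), (v 1 2, .i2, .i2)}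

/-- The pattern is independent in the model key graph. [folklore] -/
theorem T₀_key : ∀ t ∈ T₀, ∀ t' ∈ T₀, t ≠ t' → t.1 ≠ γ t.2.1 t.2.2 t'.2.1 t'.2.2 * t'.1 := by decide

/-- `#T₀ = 18`. [folklore] -/
theorem T₀_card : #T₀ = 18 := by decide

variable {G : Type*} [Group G] {z u x y : G}

/-- The coordinate homomorphism `ψ (p, q) = z^p u^q`. [folklore] -/
def ψ (hz : z ^ 3 = 1) (hu : u ^ 3 = 1) (hzu : z * u = u * z) : M →* G :=
  MonoidHom.noncommCoprod (cycHom 3 z hz) (cycHom 3 u hu) (fun m n => by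
    rw [cycHom_apply, cycHom_apply]
    exact (Commute.pow_pow hzu _ _))

section Main

variable (hz : z ^ 3 = 1) (hu : u ^ 3 = 1) (hzu : z * u = u * z)

/-- `ψ (v p q) = z ^ p.val * u ^ q.val`. [folklore] -/
theorem ψ_v (p q : ZMod 3) : ψ hz hu hzu (v p q) = z ^ p.val * u ^ q.val := by
  simp [ψ, v, MonoidHom.noncommCoprod_apply, cycHom_ofAdd]

/-- `z⁻¹ = z²`, `u⁻¹ = u²`. [folklore] -/
theorem inv_eq_sq {g : G} (hg : g ^ 3 = 1) : g⁻¹ = g ^ 2 := by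
  rw [eq_comm, ← mul_eq_one_iff_eq_inv', ← pow_succ', hg]

/-- A homomorphism out of `M` agreeing with another on `(ofAdd 1, 1)` and `(1, ofAdd 1)` is equal to it. [folklore] -/
theorem hom_ext {f g : M →* G} (h₁ : f (Multiplicative.ofAdd 1, 1) = g (Multiplicative.ofAdd 1, 1))
    (h₂ : f (1, Multiplicative.ofAdd 1) = g (1, Multiplicative.ofAdd 1)) : f = g := by
  refine prod_ext (fun a => ?_) (fun b => ?_)
  · have e := mzmod_ext (f := f.comp (MonoidHom.inl _ _)) (g := g.comp (MonoidHom.inl _ _)) (by simpa using h₁)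
    simpa using congrArg (fun φ : Multiplicative (ZMod 3) →* G => φ a) e
  · have e := mzmod_ext (f := f.comp (MonoidHom.inr _ _)) (g := g.comp (MonoidHom.inr _ _)) (by simpa using h₂)
    simpa using congrArg (fun φ : Multiplicative (ZMod 3) →* G => φ b) e

/-- Values in `ZMod 3`. [folklore] -/ theorem val0 : (0 : ZMod 3).val = 0 := rfl
/-- Values in `ZMod 3`. [folklore] -/ theorem val1 : (1 : ZMod 3).val = 1 := rfl
/-- Values in `ZMod 3`. [folklore] -/ theorem val2 : (2 : ZMod 3).val = 2 := rfl

/-- `ψ` on the two generators. [folklore] -/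
theorem ψ_gen : ψ hz hu hzu (Multiplicative.ofAdd 1, 1) = z ∧ ψ hz hu hzu (1, Multiplicative.ofAdd 1) = u := by
  constructor
  · have := ψ_v hz hu hzu 1 0
    simpa [v, ZMod.val_one] using this
  · have := ψ_v hz hu hzu 0 1
    simpa [v, ZMod.val_one] using this

/-- Conjugation by `x` in coordinates. [folklore] -/
theorem conj_x (hxz : x * z * x⁻¹ = z⁻¹) (hxu : x * u * x⁻¹ = u) (m : M) :
    x * ψ hz hu hzu m * x⁻¹ = ψ hz hu hzu (σx m) := by
  obtain ⟨g1, g2⟩ := ψ_gen hz hu hzu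
  refine conj_of_hom_eq (hom_ext ?_ ?_) m
  · have e2 : σx (Multiplicative.ofAdd (1 : ZMod 3), 1) = v 2 0 := by decide
    simp only [MonoidHom.comp_apply, MulEquiv.coe_toMonoidHom, MulAut.conj_apply, g1, e2, ψ_v, val0, val2, pow_zero,
      mul_one, hxz, inv_eq_sq hz]
  · have e2 : σx (1, Multiplicative.ofAdd (1 : ZMod 3)) = v 0 1 := by decide
    simp only [MonoidHom.comp_apply, MulEquiv.coe_toMonoidHom, MulAut.conj_apply, g2, e2, ψ_v, val0, val1, pow_zero,
      pow_one, one_mul, hxu]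

/-- Conjugation by `y` in coordinates. [folklore] -/
theorem conj_y (hyz : y * z * y⁻¹ = z) (hyu : y * u * y⁻¹ = u⁻¹) (m : M) :
    y * ψ hz hu hzu m * y⁻¹ = ψ hz hu hzu (σy m) := by
  obtain ⟨g1, g2⟩ := ψ_gen hz hu hzu
  refine conj_of_hom_eq (hom_ext ?_ ?_) m
  · have e2 : σy (Multiplicative.ofAdd (1 : ZMod 3), 1) = v 1 0 := by decide
    simp only [MonoidHom.comp_apply, MulEquiv.coe_toMonoidHom, MulAut.conj_apply, g1, e2, ψ_v, val0, val1, pow_zero,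
      pow_one, mul_one, hyz]
  · have e2 : σy (1, Multiplicative.ofAdd (1 : ZMod 3)) = v 0 2 := by decide
    simp only [MonoidHom.comp_apply, MulEquiv.coe_toMonoidHom, MulAut.conj_apply, g2, e2, ψ_v, val0, val2, pow_zero,
      one_mul, hyu, inv_eq_sq hu]

end Main

section Final

variable (hz : z ^ 3 = 1) (hu : u ^ 3 = 1) (hzu : z * u = u * z)

/-- In `ZMod 3`-coordinates: `g ^ a.val = 1` with `g³ = 1 ≠ g` forces `a = 0`. [folklore] -/
theorem eq_zero_of_pow_val {g : G} (hg : g ^ 3 = 1) (hg1 : g ≠ 1) (a : ZMod 3) (h : g ^ a.val = 1) : a = 0 := by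
  fin_cases a
  · rfl
  · change g ^ 1 = 1 at h
    exact absurd (by simpa using h) hg1
  · exfalso; apply hg1
    change g ^ 2 = 1 at h
    calc g = g ^ 3 * (g ^ 2)⁻¹ := by group
      _ = 1 := by rw [hg, h]; group

/-- `ψ` is injective (given `z, u ≠ 1` and an element `y` centralising `z` and inverting `u`). [folklore] -/
theorem ψ_injective (hyz : y * z * y⁻¹ = z) (hyu : y * u * y⁻¹ = u⁻¹) (hz1 : z ≠ 1) (hu1 : u ≠ 1) :
    Function.Injective (ψ hz hu hzu) := by
  rw [injective_iff_map_eq_one]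
  rintro ⟨a, b⟩ h
  have h2 : ψ hz hu hzu (σy (a, b)) = 1 := by rw [← conj_y hz hu hzu hyz hyu, h]; group
  have h3 : ψ hz hu hzu ((a, b) * σy (a, b)) = 1 := by rw [map_mul, h, h2, one_mul]
  have e3 : ((a, b) : M) * σy (a, b) = (a * a, 1) := by
    change ((a, b) : M) * (a, b⁻¹) = (a * a, 1); simp
  rw [e3] at h3
  have h4 : z ^ (Multiplicative.toAdd (a * a)).val = 1 := by
    simpa [ψ, MonoidHom.noncommCoprod_apply, cycHom_apply] using h3
  have ha2 : Multiplicative.toAdd (a * a) = 0 := eq_zero_of_pow_val hz hz1 _ h4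
  have ha : a = 1 := by
    have key : ∀ c : Multiplicative (ZMod 3), Multiplicative.toAdd (c * c) = 0 → c = 1 := by decide
    exact key a ha2
  subst ha
  have h5 : u ^ (Multiplicative.toAdd b).val = 1 := by
    simpa [ψ, MonoidHom.noncommCoprod_apply, cycHom_apply] using h
  have hb : Multiplicative.toAdd b = 0 := eq_zero_of_pow_val hu hu1 _ h5
  have hb' : b = 1 := toAdd_eq_zero.mp hb
  subst hb'; rfl

/-- The second box coordinate `Y = {1, z, x}` (with `z = ψ (v 1 0)`). [folklore] -/
def yv (φ : M →* G) (x : G) : Three → G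
  | .i0 => 1 | .i1 => φ (v 1 0) | .i2 => x

/-- The third box coordinate `W = {1, u, zy}`. [folklore] -/
def wv (φ : M →* G) (y : G) : Three → G
  | .i0 => 1 | .i1 => φ (v 0 1) | .i2 => φ (v 1 0) * y

/-- `g⁻¹ ≠ g` for `g³ = 1 ≠ g`. [folklore] -/
theorem inv_ne_self {g : G} (hg : g ^ 3 = 1) (hg1 : g ≠ 1) : g⁻¹ ≠ g := by
  intro h; apply hg1
  have h2 : g ^ 2 = 1 := by rw [pow_two]; nth_rw 1 [← h]; exact inv_mul_cancel g
  calc g = g ^ 3 * (g ^ 2)⁻¹ := by group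
    _ = 1 := by rw [hg, h2]; group

include hz hu hzu in
/-- **The `S₃ × S₃` configuration makes `G` box-useless (ratio `≥ 2`).** [folklore] -/
theorem not_boxUseful [Fintype G] [DecidableEq G] (hxz : x * z * x⁻¹ = z⁻¹) (hxu : x * u * x⁻¹ = u)
    (hyz : y * z * y⁻¹ = z) (hyu : y * u * y⁻¹ = u⁻¹) (hxy : x * y = y * x) (hz1 : z ≠ 1) (hu1 : u ≠ 1) :
    ¬ BoxUseful G := by
  classical
  have hinj : Function.Injective (ψ hz hu hzu) := ψ_injective hz hu hzu hyz hyu hz1 hu1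
  have gz : ψ hz hu hzu (v 1 0) = z := by rw [ψ_v]; simp [val1]
  have gu : ψ hz hu hzu (v 0 1) = u := by rw [ψ_v]; simp [val1]
  have g0 : ψ hz hu hzu (v 0 0) = 1 := by rw [ψ_v]; simp
  -- rewriting rules
  have Rx := conj_rule (conj_x hz hu hzu hxz hxu)
  have Rx' := conj_rule' (conj_x hz hu hzu hxz hxu)
  have Rxi := conj_rule_inv (conj_x hz hu hzu hxz hxu) σx_σx
  have Rxi' := conj_rule_inv' (conj_x hz hu hzu hxz hxu) σx_σx
  have Ry := conj_rule (conj_y hz hu hzu hyz hyu)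
  have Ry' := conj_rule' (conj_y hz hu hzu hyz hyu)
  have Ryi' := conj_rule_inv' (conj_y hz hu hzu hyz hyu) σy_σy
  have hc : Commute x y := hxy
  have Cyx' : y * x = x * y := hc.eq.symm
  have Cyxi : ∀ t : G, y * (x⁻¹ * t) = x⁻¹ * (y * t) := fun t => by
    rw [← mul_assoc, ← hc.inv_left.eq, mul_assoc]
  have Cyxi' : y * x⁻¹ = x⁻¹ * y := hc.inv_left.eq.symm
  have Cyixi' : y⁻¹ * x⁻¹ = x⁻¹ * y⁻¹ := hc.inv_inv.eq.symm
  -- distinctness in the box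
  have hzu' : ∀ t : G, z⁻¹ * (u * t) = u * (z⁻¹ * t) := fun t => by
    have hcz : Commute z u := hzu
    rw [← mul_assoc, hcz.inv_left.eq, mul_assoc]
  have hx1 : x ≠ 1 := by
    rintro rfl; exact inv_ne_self hz hz1 (by simpa using hxz.symm)
  have hxz' : x ≠ z := by
    rintro rfl; exact inv_ne_self hz hz1 (by simpa using hxz.symm)
  have hzy1 : z * y ≠ 1 := by
    intro h
    have hy : y = z⁻¹ := eq_inv_of_mul_eq_one_right h
    rw [hy] at hyu
    have e : z⁻¹ * u * z⁻¹⁻¹ = u := by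
      calc z⁻¹ * u * z⁻¹⁻¹ = z⁻¹ * (u * z) := by group
        _ = u := by rw [hzu']; group
    exact inv_ne_self hu hu1 (hyu.symm.trans e)
  have hzyu : z * y ≠ u := by
    intro h
    have hy : y = z⁻¹ * u := by rw [← h]; group
    rw [hy] at hyu
    have e : z⁻¹ * u * u * (z⁻¹ * u)⁻¹ = u := by
      calc z⁻¹ * u * u * (z⁻¹ * u)⁻¹ = z⁻¹ * (u * z) := by group
        _ = u := by rw [hzu']; group
    exact inv_ne_self hu hu1 (hyu.symm.trans e)
  have hy_inj : Function.Injective (yv (ψ hz hu hzu) x) := by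
    intro i j h
    cases i <;> cases j <;> simp only [yv, gz] at h
    all_goals first | rfl | exfalso
    all_goals first | exact hz1 h.symm | exact hz1 h | exact hx1 h.symm | exact hx1 h | exact hxz' h.symm | exact hxz' h
  have hw_inj : Function.Injective (wv (ψ hz hu hzu) y) := by
    intro i j h
    cases i <;> cases j <;> simp only [wv, gz, gu] at h
    all_goals first | rfl | exfalso
    all_goals first | exact hu1 h.symm | exact hu1 h | exact hzy1 h.symm | exact hzy1 h | exact hzyu h.symm | exact hzyu h
  have hM : 9 * Fintype.card M ≤ 5 * #T₀ := by
    rw [T₀_card]; simp [M, Fintype.card_prod, ZMod.card]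
  refine not_boxUseful_of_model (ψ hz hu hzu) hinj (yv (ψ hz hu hzu) x) (wv (ψ hz hu hzu) y) hy_inj hw_inj rfl rfl
    γ ?_ T₀ T₀_key hM
  intro i j i' j'
  cases i <;> cases j <;> cases i' <;> cases j' <;>
  · simp only [yv, wv, γ, gaugeWord, mul_assoc, mul_inv_rev, inv_one, one_mul, mul_one, psi_mul_left, psi_mul,
      psi_inv, Rx, Rx', Rxi, Rxi', Ry, Ry', Ryi', Cyx', Cyxi, Cyxi', Cyixi', mul_inv_cancel_left, mul_inv_cancel,
      map_one]
    first | exact g0.symm | (apply congrArg (ψ hz hu hzu); decide)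

end Final

end S3S3Config

end Summit.MatrixMultiplication.OmegaCensus
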